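import Literature.AlgebraicGeometry.Motives.HodgeLieSemisimpleTimesAbelian
import Literature.AlgebraicGeometry.Motives.HodgeLieDiagonal
import HarnessLib

/-!
# `dim 𝔥(H' ⊕ H₂) = dim 𝔥(H')` when `H₂` is already a direct summand of `H'` — a duplicate summand does not change the Hodge Lie algebra
# (Moonen–Zarhin 1999 §1 / Moonen (1.8): `Hg(X × B) = Hg(X)` for `B` a factor of `X`, through the diagonal action)

Family `hodge`, layer `Literature/AlgebraicGeometry/Motives`; THEOREMS ONLY (no definition, no named fact).  Written for the cell
`pub-hodgecm2` (COR-CM), seat `b27` gen 48 (count-neutral Mumford–Tate-rank ladder: towards `t(A × B^{m+1}) = t(A × B)`, the step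
needed to run the Weil-class argument of `Motives/HodgeLieWeilClassesProductCorner` on `A × E^{g−2}` for Ribet type `(g−1,1)`).
The tree has the pure-power case `𝔥(H^{⊕ι}) = Δ𝔥(H)` (`Motives/HodgeLieDiagonal`); this file adds ONE duplicate of a summand that is
already present, which by induction covers `H₁ ⊕ H₂^{⊕(m+1)}`.

SETTING.  `H' ≅ H₁ ⊕ H₂` (morphisms `ι₁', π₁', ι₂', π₂'`, `π_i' ι_i' = id`, `ι₁'π₁' + ι₂'π₂' = id`) and `H ≅ H' ⊕ H₂` (morphisms
`ι₀, π₀, ι₃, π₃`, `π₀ι₀ = id`, `π₃ι₃ = id`, `ι₀π₀ + ι₃π₃ = id`), any weight.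

RESULTS.
* §1 **`duplicate_mem_hodgeLie`** — for `Y ∈ 𝔥(H')` the operator `X = ι₀ Y π₀ + ι₃ (π₂' Y ι₂') π₃` («`Y` on `H'`, the `H₂`-block of `Y` once
  more on the new copy») lies in `𝔥(H)`: Moonen's block transfer `mem_hodgeLie_of_blocks` with the two block pairs `(ι₀, π₀)`,
  `(ι₃π₂', ι₂'π₃)` from `H'` (they sum to `id`), using that `Y` has no off-diagonal blocks (`eq_sum_blocks_of_mem_hodgeLie`).
* §2 **`restrict_dup_block_eq`** — for `X ∈ 𝔥(H)` the new diagonal block is dictated by the old one: `π₃ X ι₃ = π₂' (π₀ X ι₀) ι₂'`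
  (`X` commutes with the Hodge endomorphism `ι₃ π₂' π₀` of `H`), whence `X ↦ π₀ X ι₀`, `𝔥(H) → 𝔥(H')`, is INJECTIVE
  (`eq_of_restrict₀_eq`).
* §3 **`finrank_hodgeLie_eq_of_duplicate_summand`**: `dim_ℚ 𝔥(H) = dim_ℚ 𝔥(H')` (two injective linear maps).
AV reading (for `CorCM`): `dim Lie Hg(H¹((A × B) × B)) = dim Lie Hg(H¹(A × B))`, `t((A × B) × B) = t(A × B)`, `t(A × B^{m+1}) = t(A × B)`.

## References
* [MoonenZarhin1999LowDim] B. Moonen, Yu. G. Zarhin, Math. Ann. 315 (1999), §1 and §3 (3.1) [corpus: paper:arxiv-math_9901113 pp. 2, 6].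
  [cite: MoonenZarhin1999LowDim, §1 and §3]
* [Moonen1999MTNotes] B. Moonen, *Notes on Mumford–Tate groups* (1999), (1.8), (1.13). [cite: Moonen1999MTNotes, (1.8) and (1.13)]
* [Deligne1982HodgeCycles] P. Deligne, LNM 900 (1982), I §3.1 and Prop. 3.4. [cite: Deligne1982HodgeCycles, I §3.1 and Prop. 3.4]
-/

noncomputable section

namespace Literature.AlgebraicGeometry.Motives

namespace HodgeStructure

universe u

variable {V₁ : Type u} [AddCommGroup V₁] [Module ℚ V₁] [Module.Finite ℚ V₁]
  {V₂ : Type u} [AddCommGroup V₂] [Module ℚ V₂] [Module.Finite ℚ V₂]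
  {V' : Type u} [AddCommGroup V'] [Module ℚ V'] [Module.Finite ℚ V']
  {V : Type u} [AddCommGroup V] [Module ℚ V] [Module.Finite ℚ V] [HodgeTensorFacts.{u, u}] {n : ℤ}
  {H₁ : HodgeStructure V₁ n} {H₂ : HodgeStructure V₂ n} {H' : HodgeStructure V' n} {H : HodgeStructure V n}
  (ι₁' : Hom H₁ H') (π₁' : Hom H' H₁) (ι₂' : Hom H₂ H') (π₂' : Hom H' H₂)
  (hπι₁' : ∀ v, π₁'.toLinearMap (ι₁'.toLinearMap v) = v) (hπι₂' : ∀ v, π₂'.toLinearMap (ι₂'.toLinearMap v) = v)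
  (hsum' : ∀ v, ι₁'.toLinearMap (π₁'.toLinearMap v) + ι₂'.toLinearMap (π₂'.toLinearMap v) = v)
  (ι₀ : Hom H' H) (π₀ : Hom H H') (ι₃ : Hom H₂ H) (π₃ : Hom H H₂)
  (hπι₀ : ∀ v, π₀.toLinearMap (ι₀.toLinearMap v) = v) (hπι₃ : ∀ v, π₃.toLinearMap (ι₃.toLinearMap v) = v)
  (hsum : ∀ v, ι₀.toLinearMap (π₀.toLinearMap v) + ι₃.toLinearMap (π₃.toLinearMap v) = v)

omit [Module.Finite ℚ V'] [Module.Finite ℚ V₂] [Module.Finite ℚ V] [HodgeTensorFacts.{u, u}] in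
include hπι₀ hπι₃ hsum in
/-- `π₃ ι₀ = 0`. [folklore] -/
private theorem proj₃_incl₀_eq_zero (v : V') : π₃.toLinearMap (ι₀.toLinearMap v) = 0 := by
  have h := congrArg π₃.toLinearMap (hsum (ι₀.toLinearMap v))
  rw [map_add, hπι₀ v, hπι₃] at h
  exact add_eq_left.1 h

omit [Module.Finite ℚ V'] [Module.Finite ℚ V₂] [Module.Finite ℚ V] [HodgeTensorFacts.{u, u}] in
include hπι₀ hπι₃ hsum in
/-- `π₀ ι₃ = 0`. [folklore] -/
private theorem proj₀_incl₃_eq_zero (v : V₂) : π₀.toLinearMap (ι₃.toLinearMap v) = 0 := by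
  have h := congrArg π₀.toLinearMap (hsum (ι₃.toLinearMap v))
  rw [map_add, hπι₃ v, hπι₀] at h
  exact add_eq_left.1 h

omit [Module.Finite ℚ V'] [Module.Finite ℚ V₂] [Module.Finite ℚ V₁] [HodgeTensorFacts.{u, u}] in
include hπι₁' hπι₂' hsum' in
/-- `π₂' ι₁' = 0`. [folklore] -/
private theorem proj₂'_incl₁'_eq_zero (v : V₁) : π₂'.toLinearMap (ι₁'.toLinearMap v) = 0 := by
  have h := congrArg π₂'.toLinearMap (hsum' (ι₁'.toLinearMap v))
  rw [map_add, hπι₁' v, hπι₂'] at h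
  exact add_eq_left.1 h

omit [Module.Finite ℚ V'] [Module.Finite ℚ V₂] [Module.Finite ℚ V₁] [HodgeTensorFacts.{u, u}] in
include hπι₁' hπι₂' hsum' in
/-- `π₁' ι₂' = 0`. [folklore] -/
private theorem proj₁'_incl₂'_eq_zero (v : V₂) : π₁'.toLinearMap (ι₂'.toLinearMap v) = 0 := by
  have h := congrArg π₁'.toLinearMap (hsum' (ι₂'.toLinearMap v))
  rw [map_add, hπι₂' v, hπι₁'] at h
  exact add_eq_left.1 h

/-! ## §1 The duplicated operator lies in `𝔥(H)` -/

omit [Module.Finite ℚ V₁] [Module.Finite ℚ V₂] in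
include hπι₁' hπι₂' hsum' in
/-- The off-diagonal blocks of `Y ∈ 𝔥(H')` vanish: `π₂' Y = (π₂' Y ι₂') π₂'` and `Y ι₂' = ι₂' (π₂' Y ι₂')`.
[cite: Deligne1982HodgeCycles, I §3.1 and Prop. 3.4] -/
theorem proj₂_comp_eq_and_comp_incl₂_eq {Y : Module.End ℚ V'} (hY : Y ∈ H'.hodgeLie) :
    π₂'.toLinearMap ∘ₗ Y = (π₂'.toLinearMap ∘ₗ Y ∘ₗ ι₂'.toLinearMap) ∘ₗ π₂'.toLinearMap ∧
      Y ∘ₗ ι₂'.toLinearMap = ι₂'.toLinearMap ∘ₗ (π₂'.toLinearMap ∘ₗ Y ∘ₗ ι₂'.toLinearMap) := by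
  have hY' := eq_sum_blocks_of_mem_hodgeLie ι₁' π₁' ι₂' π₂' hπι₁' hπι₂' hsum' hY
  have h21 := proj₂'_incl₁'_eq_zero ι₁' π₁' ι₂' π₂' hπι₁' hπι₂' hsum'
  have h12 := proj₁'_incl₂'_eq_zero ι₁' π₁' ι₂' π₂' hπι₁' hπι₂' hsum'
  constructor
  · refine LinearMap.ext fun v => ?_
    conv_lhs => rw [hY']
    simp only [LinearMap.comp_apply, LinearMap.add_apply, map_add, h21, hπι₂', zero_add]
  · refine LinearMap.ext fun v => ?_
    conv_lhs => rw [hY']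
    simp only [LinearMap.comp_apply, LinearMap.add_apply, h12, hπι₂', map_zero, zero_add]

omit [Module.Finite ℚ V₁] [Module.Finite ℚ V₂] in
include hπι₁' hπι₂' hsum' hπι₀ hπι₃ hsum in
/-- **The duplicated operator is in `𝔥(H)`**: for `Y ∈ 𝔥(H')`, `X = ι₀ Y π₀ + ι₃ (π₂' Y ι₂') π₃ ∈ 𝔥(H)` — Moonen's transfer along the two
block pairs `(ι₀, π₀)` and `(ι₃ π₂', ι₂' π₃)` from `H'` (`ι₀π₀ + ι₃π₂'ι₂'π₃ = id`), the intertwining relations holding because the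
off-diagonal blocks of `Y` vanish. [cite: Moonen1999MTNotes, (1.8) and (1.13)] [cite: MoonenZarhin1999LowDim, §1 and §3] -/
theorem duplicate_mem_hodgeLie {Y : Module.End ℚ V'} (hY : Y ∈ H'.hodgeLie) :
    ι₀.toLinearMap ∘ₗ Y ∘ₗ π₀.toLinearMap +
      ι₃.toLinearMap ∘ₗ (π₂'.toLinearMap ∘ₗ Y ∘ₗ ι₂'.toLinearMap) ∘ₗ π₃.toLinearMap ∈ H.hodgeLie := by
  classical
  obtain ⟨hπY, hYι⟩ := proj₂_comp_eq_and_comp_incl₂_eq ι₁' π₁' ι₂' π₂' hπι₁' hπι₂' hsum' hY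
  set Y₂ := π₂'.toLinearMap ∘ₗ Y ∘ₗ ι₂'.toLinearMap with hY₂
  have h30 := proj₃_incl₀_eq_zero ι₀ π₀ ι₃ π₃ hπι₀ hπι₃ hsum
  have h03 := proj₀_incl₃_eq_zero ι₀ π₀ ι₃ π₃ hπι₀ hπι₃ hsum
  -- the two block pairs from `H'`
  let inj : Fin 2 → Hom H' H := ![ι₀, ι₃.comp π₂']
  let pr : Fin 2 → Hom H H' := ![π₀, ι₂'.comp π₃]
  have hblocks : ∑ j, (inj j).toLinearMap ∘ₗ (pr j).toLinearMap = LinearMap.id := by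
    rw [Fin.sum_univ_two]
    refine LinearMap.ext fun v => ?_
    change ι₀.toLinearMap (π₀.toLinearMap v) + ι₃.toLinearMap (π₂'.toLinearMap (ι₂'.toLinearMap (π₃.toLinearMap v))) = v
    rw [hπι₂', hsum]
  refine mem_hodgeLie_of_blocks inj pr hblocks hY ?_ ?_
  · intro j
    fin_cases j
    · change ι₀.toLinearMap ∘ₗ Y = (ι₀.toLinearMap ∘ₗ Y ∘ₗ π₀.toLinearMap + ι₃.toLinearMap ∘ₗ Y₂ ∘ₗ π₃.toLinearMap) ∘ₗ ι₀.toLinearMap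
      refine LinearMap.ext fun v => ?_
      simp only [LinearMap.comp_apply, LinearMap.add_apply, hπι₀, h30, map_zero, add_zero]
    · change (ι₃.toLinearMap ∘ₗ π₂'.toLinearMap) ∘ₗ Y =
        (ι₀.toLinearMap ∘ₗ Y ∘ₗ π₀.toLinearMap + ι₃.toLinearMap ∘ₗ Y₂ ∘ₗ π₃.toLinearMap) ∘ₗ (ι₃.toLinearMap ∘ₗ π₂'.toLinearMap)
      rw [LinearMap.comp_assoc, hπY]
      refine LinearMap.ext fun v => ?_
      simp only [LinearMap.comp_apply, LinearMap.add_apply, hπι₃, h03, map_zero, zero_add]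
  · intro j
    fin_cases j
    · change π₀.toLinearMap ∘ₗ (ι₀.toLinearMap ∘ₗ Y ∘ₗ π₀.toLinearMap + ι₃.toLinearMap ∘ₗ Y₂ ∘ₗ π₃.toLinearMap) = Y ∘ₗ π₀.toLinearMap
      refine LinearMap.ext fun v => ?_
      simp only [LinearMap.comp_apply, LinearMap.add_apply, map_add, hπι₀, h03, add_zero]
    · change (ι₂'.toLinearMap ∘ₗ π₃.toLinearMap) ∘ₗ (ι₀.toLinearMap ∘ₗ Y ∘ₗ π₀.toLinearMap + ι₃.toLinearMap ∘ₗ Y₂ ∘ₗ π₃.toLinearMap) =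
        Y ∘ₗ (ι₂'.toLinearMap ∘ₗ π₃.toLinearMap)
      have hYιv : ∀ w, Y (ι₂'.toLinearMap w) = ι₂'.toLinearMap (Y₂ w) := fun w => LinearMap.congr_fun hYι w
      refine LinearMap.ext fun v => ?_
      simp only [LinearMap.comp_apply, LinearMap.add_apply, map_add, hπι₃, h30, map_zero, zero_add, hYιv]

/-! ## §2 The new block is dictated by the old one: restriction to `H'` is injective on `𝔥(H)` -/

omit [Module.Finite ℚ V₁] [Module.Finite ℚ V₂] [Module.Finite ℚ V'] in
include hπι₂' hπι₀ hπι₃ in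
/-- **`π₃ X ι₃ = π₂' (π₀ X ι₀) ι₂'` for `X ∈ 𝔥(H)`**: `X` commutes with the Hodge endomorphism `ι₃ π₂' π₀` of `H` («copy the `H₂`-block of `H'`
onto the new summand»), and `π₂' π₀ ι₀ ι₂' = id`. [cite: Deligne1982HodgeCycles, I §3.1 and Prop. 3.4] [cite: Moonen1999MTNotes, (1.8)] -/
theorem restrict_dup_block_eq {X : Module.End ℚ V} (hX : X ∈ H.hodgeLie) :
    π₃.toLinearMap ∘ₗ X ∘ₗ ι₃.toLinearMap =
      π₂'.toLinearMap ∘ₗ (π₀.toLinearMap ∘ₗ X ∘ₗ ι₀.toLinearMap) ∘ₗ ι₂'.toLinearMap := by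
  -- the Hodge endomorphism `f = ι₃ π₂' π₀`
  have hf := commute_of_mem_hodgeLie H hX ⟨((ι₃.comp π₂').comp π₀).toLinearMap, Hom.toLinearMap_mem_endAlg _⟩
  have hf' : ∀ v, X (ι₃.toLinearMap (π₂'.toLinearMap (π₀.toLinearMap v))) = ι₃.toLinearMap (π₂'.toLinearMap (π₀.toLinearMap (X v))) :=
    fun v => by
      have h := LinearMap.congr_fun hf v
      exact h
  refine LinearMap.ext fun w => ?_
  have h := congrArg π₃.toLinearMap (hf' (ι₀.toLinearMap (ι₂'.toLinearMap w)))
  rw [hπι₀, hπι₂', hπι₃] at h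
  simp only [LinearMap.comp_apply]
  exact h

omit [Module.Finite ℚ V₁] [Module.Finite ℚ V₂] [Module.Finite ℚ V'] in
include hπι₂' hπι₀ hπι₃ hsum in
/-- **`X ↦ π₀ X ι₀` is injective on `𝔥(H)`**: `X = ι₀(π₀Xι₀)π₀ + ι₃(π₃Xι₃)π₃` (`eq_sum_blocks_of_mem_hodgeLie`) and the second block is a
function of the first (`restrict_dup_block_eq`). [cite: Deligne1982HodgeCycles, I §3.1 and Prop. 3.4] -/
theorem eq_of_restrict₀_eq {X X' : Module.End ℚ V} (hX : X ∈ H.hodgeLie) (hX' : X' ∈ H.hodgeLie)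
    (h : π₀.toLinearMap ∘ₗ X ∘ₗ ι₀.toLinearMap = π₀.toLinearMap ∘ₗ X' ∘ₗ ι₀.toLinearMap) : X = X' := by
  rw [eq_sum_blocks_of_mem_hodgeLie ι₀ π₀ ι₃ π₃ hπι₀ hπι₃ hsum hX, eq_sum_blocks_of_mem_hodgeLie ι₀ π₀ ι₃ π₃ hπι₀ hπι₃ hsum hX',
    restrict_dup_block_eq ι₂' π₂' hπι₂' ι₀ π₀ ι₃ π₃ hπι₀ hπι₃ hX, restrict_dup_block_eq ι₂' π₂' hπι₂' ι₀ π₀ ι₃ π₃ hπι₀ hπι₃ hX', h]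

/-! ## §3 Equality of dimensions -/

omit [Module.Finite ℚ V₁] [Module.Finite ℚ V₂] in
include hπι₁' hπι₂' hsum' hπι₀ hπι₃ hsum in
/-- **`dim_ℚ 𝔥(H' ⊕ H₂) = dim_ℚ 𝔥(H')` when `H₂` is a direct summand of `H'`** — a duplicate summand does not change the Hodge Lie
algebra (`Hg(X × B) ≅ Hg(X)` for `B` a factor of `X`, acting diagonally).  `≤`: restriction `X ↦ π₀Xι₀` is injective (§2);
`≥`: duplication `Y ↦ ι₀Yπ₀ + ι₃(π₂'Yι₂')π₃` is injective (§1, `π₀(·)ι₀` retrieves `Y`).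
[cite: MoonenZarhin1999LowDim, §1 and §3] [cite: Moonen1999MTNotes, (1.8) and (1.13)] [cite: Deligne1982HodgeCycles, I §3.1 and Prop. 3.4] -/
theorem finrank_hodgeLie_eq_of_duplicate_summand :
    Module.finrank ℚ H.hodgeLie = Module.finrank ℚ H'.hodgeLie := by
  classical
  have h30 := proj₃_incl₀_eq_zero ι₀ π₀ ι₃ π₃ hπι₀ hπι₃ hsum
  have h03 := proj₀_incl₃_eq_zero ι₀ π₀ ι₃ π₃ hπι₀ hπι₃ hsum
  -- restriction `R : 𝔥(H) → 𝔥(H')`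
  let r : Module.End ℚ V →ₗ[ℚ] Module.End ℚ V' :=
    (LinearMap.llcomp ℚ V' V V' π₀.toLinearMap).comp (LinearMap.lcomp ℚ V ι₀.toLinearMap)
  have hr : ∀ X, r X = π₀.toLinearMap ∘ₗ X ∘ₗ ι₀.toLinearMap := fun X => rfl
  let R : H.hodgeLie →ₗ[ℚ] H'.hodgeLie :=
    LinearMap.codRestrict H'.hodgeLie (r.comp H.hodgeLie.subtype) fun X => by
      rw [LinearMap.comp_apply, Submodule.subtype_apply, hr]; exact comp_mem_hodgeLie_of_retract ι₀ π₀ hπι₀ X.2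
  have hRval : ∀ X : H.hodgeLie, ((R X : H'.hodgeLie) : Module.End ℚ V') = π₀.toLinearMap ∘ₗ (X : Module.End ℚ V) ∘ₗ ι₀.toLinearMap :=
    fun X => rfl
  have hRinj : Function.Injective R := fun X X' hXX' => by
    apply Subtype.ext
    exact eq_of_restrict₀_eq ι₂' π₂' hπι₂' ι₀ π₀ ι₃ π₃ hπι₀ hπι₃ hsum X.2 X'.2 (by rw [← hRval, ← hRval, hXX'])
  -- duplication `D : 𝔥(H') → 𝔥(H)`
  let d : Module.End ℚ V' →ₗ[ℚ] Module.End ℚ V :=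
    (LinearMap.llcomp ℚ V V' V ι₀.toLinearMap).comp (LinearMap.lcomp ℚ V' π₀.toLinearMap) +
      (LinearMap.llcomp ℚ V V₂ V ι₃.toLinearMap).comp ((LinearMap.lcomp ℚ V₂ π₃.toLinearMap).comp
        ((LinearMap.llcomp ℚ V₂ V' V₂ π₂'.toLinearMap).comp (LinearMap.lcomp ℚ V' ι₂'.toLinearMap)))
  have hd : ∀ Y, d Y = ι₀.toLinearMap ∘ₗ Y ∘ₗ π₀.toLinearMap +
      ι₃.toLinearMap ∘ₗ (π₂'.toLinearMap ∘ₗ Y ∘ₗ ι₂'.toLinearMap) ∘ₗ π₃.toLinearMap := fun Y => rfl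
  let D : H'.hodgeLie →ₗ[ℚ] H.hodgeLie :=
    LinearMap.codRestrict H.hodgeLie (d.comp H'.hodgeLie.subtype) fun Y => by
      rw [LinearMap.comp_apply, Submodule.subtype_apply, hd]
      exact duplicate_mem_hodgeLie ι₁' π₁' ι₂' π₂' hπι₁' hπι₂' hsum' ι₀ π₀ ι₃ π₃ hπι₀ hπι₃ hsum Y.2
  have hDval : ∀ Y : H'.hodgeLie, ((D Y : H.hodgeLie) : Module.End ℚ V) = ι₀.toLinearMap ∘ₗ (Y : Module.End ℚ V') ∘ₗ π₀.toLinearMap +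
      ι₃.toLinearMap ∘ₗ (π₂'.toLinearMap ∘ₗ (Y : Module.End ℚ V') ∘ₗ ι₂'.toLinearMap) ∘ₗ π₃.toLinearMap := fun Y => rfl
  have hretr : ∀ Y : Module.End ℚ V', π₀.toLinearMap ∘ₗ (ι₀.toLinearMap ∘ₗ Y ∘ₗ π₀.toLinearMap +
      ι₃.toLinearMap ∘ₗ (π₂'.toLinearMap ∘ₗ Y ∘ₗ ι₂'.toLinearMap) ∘ₗ π₃.toLinearMap) ∘ₗ ι₀.toLinearMap = Y := fun Y => by
    refine LinearMap.ext fun v => ?_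
    simp only [LinearMap.comp_apply, LinearMap.add_apply, hπι₀, h30, map_zero, add_zero]
  have hDinj : Function.Injective D := fun Y Y' hYY' => by
    apply Subtype.ext
    have h := congrArg (fun Z : H.hodgeLie => π₀.toLinearMap ∘ₗ (Z : Module.End ℚ V) ∘ₗ ι₀.toLinearMap) hYY'
    simp only [hDval, hretr] at h
    exact h
  exact le_antisymm (LinearMap.finrank_le_finrank_of_injective hRinj) (LinearMap.finrank_le_finrank_of_injective hDinj)

end HodgeStructure

end Literature.AlgebraicGeometry.Motives

end
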